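import Literature.Analysis.FluidPDE.TwoHalfWeakSection
import HarnessLib

/-!
# Descent of a `2½`-dimensional weak Navier–Stokes solution: the vertical section is a weak
  sourced passive scalar on `T²`

Analysis/FluidPDE support file (all proved), continuation of
`Literature/Analysis/FluidPDE/TwoHalfWeakSection` (Majda–Bertozzi 2002, §2.3.1; the converse of the
lift of Bardos–Titi–Wiedemann 2012, proof of Cor. 2). If `u(t) = (v(t), θ(t)) ∘ π` is a forced weak
(pressure-free) Navier–Stokes solution on `T³ × [0, T)` (`Torus.IsWeakNSSolutionForcedOn`) with force
`(G(t), H(t)) ∘ π` and datum `(v₀, θ₀) ∘ π`, with `u(t) ∈ L²` of uniformly bounded norm on `(0, T)`,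
`θ₀ ∈ L²` and a jointly measurable source `H ∈ L¹((0,T) × T²)`, then `θ` is a weak solution of the
sourced advection–diffusion equation `∂ₜθ + v·∇θ = νΔθ + H` with datum `θ₀` in the accepted sense
`Torus.IsWeakScalarTransportForcedOn` (`Torus.isWeakScalarTransportForcedOn_of_twoHalf`): test the
three-dimensional identity with the purely vertical lifts `(0, ψ(t)) ∘ π` of the scalar test
functions (automatically divergence free); the integrability bookkeeping (`L^∞L²` bounds at every
`t ∈ (0, T)`) is needed to split the space–time integral into its transport and source parts.

## References

* A. J. Majda, A. L. Bertozzi, *Vorticity and Incompressible Flow* (CUP 2002), §2.3.1, Prop. 2.7.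
* C. Bardos, E. S. Titi, E. Wiedemann, C. R. Math. Acad. Sci. Paris 350 (2012), proof of Cor. 2.
* R. J. DiPerna, P.-L. Lions, Invent. Math. 98 (1989), §II.1 (weak transport equations).
-/

open MeasureTheory Set Filter Topology Function UnitAddTorus
open scoped ENNReal NNReal InnerProductSpace ContDiff
open Literature.Analysis.FunctionSpaces.Torus

noncomputable section

namespace Literature.Analysis.FluidPDE

namespace Torus

/-! ## The vertical section is a weak sourced scalar on `T²` -/

section ScalarWeak

variable {T ν : ℝ} {G : ℝ → (UnitAddTorus (Fin 2)) → (EuclideanSpace ℝ (Fin 2))} {H : ℝ → (UnitAddTorus (Fin 2)) → ℝ} {v₀ : (UnitAddTorus (Fin 2)) → (EuclideanSpace ℝ (Fin 2))} {θ₀ : (UnitAddTorus (Fin 2)) → ℝ}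
  {v : ℝ → (UnitAddTorus (Fin 2)) → (EuclideanSpace ℝ (Fin 2))} {θ : ℝ → (UnitAddTorus (Fin 2)) → ℝ}

/-- The products `‖V(πx)‖ ‖R(πx)‖` are dominated by `‖(V,R)∘π (x)‖²`, in `ℝ≥0∞`. [folklore] -/
theorem enorm_left_mul_enorm_right_le (V : (UnitAddTorus (Fin 2)) → (EuclideanSpace ℝ (Fin 2))) (R : (UnitAddTorus (Fin 2)) → ℝ) (x : (UnitAddTorus (Fin 3))) :
    ‖V (planarProj x)‖ₑ * ‖R (planarProj x)‖ₑ ≤ ‖twoHalf V R x‖ₑ ^ 2 := by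
  rw [← ofReal_norm, ← ofReal_norm, ← ofReal_norm, ← ENNReal.ofReal_mul (norm_nonneg _),
    ← ENNReal.ofReal_pow (norm_nonneg _)]
  refine ENNReal.ofReal_le_ofReal ?_
  rw [sq]
  exact mul_le_mul (norm_left_le_norm_twoHalf V R x) (norm_right_le_norm_twoHalf V R x) (norm_nonneg _) (norm_nonneg _)

/-- `∫⁻ ‖V‖ₑ ‖R‖ₑ ≤ ∫⁻ ‖(V,R)∘π‖ₑ²` (no measurability). [folklore] -/
theorem lintegral_enorm_mul_le_twoHalf (V : (UnitAddTorus (Fin 2)) → (EuclideanSpace ℝ (Fin 2))) (R : (UnitAddTorus (Fin 2)) → ℝ) :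
    ∫⁻ y, ‖V y‖ₑ * ‖R y‖ₑ ≤ ∫⁻ x, ‖twoHalf V R x‖ₑ ^ 2 := by
  have h := lintegral_map_le (μ := (volume : Measure (UnitAddTorus (Fin 3)))) (fun y : (UnitAddTorus (Fin 2)) => ‖V y‖ₑ * ‖R y‖ₑ) planarProj
  rw [measurePreserving_planarProj.map_eq] at h
  exact h.trans (lintegral_mono fun x => enorm_left_mul_enorm_right_le V R x)

/-- The scalar integrand `y ↦ θ (∂ₜψ + ⟪v, ∇ψ⟫ + νΔψ)` is integrable at `L²` slices. [folklore] -/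
theorem integrable_scalarIntegrand {ψ : ℝ → (UnitAddTorus (Fin 2)) → ℝ} (hψ : IsSpaceTimeTest T ψ) {t : ℝ}
    (hv : MemLp (v t) 2 volume) (hθ : MemLp (θ t) 2 volume) :
    Integrable (fun y => θ t y * (FunctionSpaces.Torus.timeDeriv ψ t y +
      ⟪v t y, FunctionSpaces.Torus.gradient (ψ t) y⟫_ℝ + ν * FunctionSpaces.Torus.laplacian (ψ t) y)) volume := by
  obtain ⟨M₁, hM₁⟩ := exists_bound_of_continuous_uncurry hψ.continuous_uncurry_timeDeriv t t
  obtain ⟨M₂, hM₂⟩ := exists_bound_of_continuous_uncurry hψ.continuous_uncurry_laplacian t t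
  have h1 : Integrable (fun y => θ t y * FunctionSpaces.Torus.timeDeriv ψ t y) volume :=
    integrable_mul_slice hψ.continuous_uncurry_timeDeriv (hM₁ t ⟨le_rfl, le_rfl⟩) hθ
  have h2 := integrable_mul_inner_gradient_slice hψ hv hθ
  have h3 : Integrable (fun y => θ t y * FunctionSpaces.Torus.laplacian (ψ t) y) volume :=
    integrable_mul_slice (φ' := fun t => FunctionSpaces.Torus.laplacian (ψ t)) hψ.continuous_uncurry_laplacian
      (hM₂ t ⟨le_rfl, le_rfl⟩) hθ
  refine ((h1.add h2).add (h3.const_mul ν)).congr (ae_of_all _ fun y => ?_)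
  simp only [Pi.add_apply]
  ring

/-- Time integrability of `t ↦ ∫ θ (∂ₜψ + ⟪v, ∇ψ⟫ + νΔψ)` on `(0, T)` under joint measurability
and uniform `L²` bounds. [folklore] -/
theorem integrableOn_integral_scalarIntegrand {ψ : ℝ → (UnitAddTorus (Fin 2)) → ℝ} (hψ : IsSpaceTimeTest T ψ)
    (hvm : AEStronglyMeasurable (uncurry v) ((volume.restrict (Ioo 0 T)).prod (volume : Measure (UnitAddTorus (Fin 2)))))
    (hθm : AEStronglyMeasurable (uncurry θ) ((volume.restrict (Ioo 0 T)).prod (volume : Measure (UnitAddTorus (Fin 2)))))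
    (hv : ∀ t ∈ Ioo 0 T, MemLp (v t) 2 volume) (hθ : ∀ t ∈ Ioo 0 T, MemLp (θ t) 2 volume)
    {Cv Cθ : ℝ} (hCv : ∀ t ∈ Ioo 0 T, ∫ y, ‖v t y‖ ^ 2 ≤ Cv) (hCθ : ∀ t ∈ Ioo 0 T, ∫ y, ‖θ t y‖ ^ 2 ≤ Cθ) :
    IntegrableOn (fun t => ∫ y, θ t y * (FunctionSpaces.Torus.timeDeriv ψ t y +
      ⟪v t y, FunctionSpaces.Torus.gradient (ψ t) y⟫_ℝ + ν * FunctionSpaces.Torus.laplacian (ψ t) y)) (Ioo 0 T) volume := by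
  have h1 := integrableOn_integral_mul hψ.continuous_uncurry_timeDeriv hθm hθ hCθ
  have h2 := integrableOn_integral_mul_inner_gradient hψ hvm hθm hv hθ hCv hCθ
  have h3 := integrableOn_integral_mul (φ' := fun t => FunctionSpaces.Torus.laplacian (ψ t))
    hψ.continuous_uncurry_laplacian hθm hθ hCθ
  refine ((h1.add h2).add (h3.const_mul ν)).congr_fun (fun t ht => ?_) measurableSet_Ioo
  obtain ⟨M₁, hM₁⟩ := exists_bound_of_continuous_uncurry hψ.continuous_uncurry_timeDeriv t t
  obtain ⟨M₂, hM₂⟩ := exists_bound_of_continuous_uncurry hψ.continuous_uncurry_laplacian t t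
  have i1 : Integrable (fun y => θ t y * FunctionSpaces.Torus.timeDeriv ψ t y) volume :=
    integrable_mul_slice hψ.continuous_uncurry_timeDeriv (hM₁ t ⟨le_rfl, le_rfl⟩) (hθ t ht)
  have i2 := integrable_mul_inner_gradient_slice hψ (hv t ht) (hθ t ht)
  have i3 : Integrable (fun y => θ t y * FunctionSpaces.Torus.laplacian (ψ t) y) volume :=
    integrable_mul_slice (φ' := fun t => FunctionSpaces.Torus.laplacian (ψ t)) hψ.continuous_uncurry_laplacian
      (hM₂ t ⟨le_rfl, le_rfl⟩) (hθ t ht)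
  show ((∫ y, θ t y * FunctionSpaces.Torus.timeDeriv ψ t y) + ∫ y, θ t y * ⟪v t y, FunctionSpaces.Torus.gradient (ψ t) y⟫_ℝ) +
      ν * (∫ y, θ t y * FunctionSpaces.Torus.laplacian (ψ t) y) = _
  have i12 : Integrable (fun y => θ t y * FunctionSpaces.Torus.timeDeriv ψ t y +
      θ t y * ⟪v t y, FunctionSpaces.Torus.gradient (ψ t) y⟫_ℝ) volume := i1.add i2
  have i3' : Integrable (fun y => ν * (θ t y * FunctionSpaces.Torus.laplacian (ψ t) y)) volume := i3.const_mul ν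
  rw [← integral_add i1 i2, ← integral_const_mul, ← integral_add i12 i3']
  refine integral_congr_ae (ae_of_all _ fun y => ?_)
  ring

/-- The source pairing `(t, y) ↦ H t y ψ t y` is integrable on `(0, T) × T²` for a jointly
measurable source in `L¹((0,T) × T²)` and a space–time test function `ψ`. [folklore] -/
theorem integrable_uncurry_source_mul {ψ : ℝ → (UnitAddTorus (Fin 2)) → ℝ} (hψ : IsSpaceTimeTest T ψ)
    (hHm : AEStronglyMeasurable (uncurry H) ((volume.restrict (Ioo 0 T)).prod (volume : Measure (UnitAddTorus (Fin 2)))))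
    (hH1 : ∫⁻ t in Ioo 0 T, ∫⁻ y, ‖H t y‖ₑ < ⊤) :
    Integrable (uncurry fun t y => H t y * ψ t y) ((volume.restrict (Ioo 0 T)).prod (volume : Measure (UnitAddTorus (Fin 2)))) := by
  obtain ⟨M, hM⟩ := exists_bound_of_continuous_uncurry hψ.continuous_uncurry 0 T
  have hHi : Integrable (uncurry H) ((volume.restrict (Ioo 0 T)).prod (volume : Measure (UnitAddTorus (Fin 2)))) := by
    refine ⟨hHm, ?_⟩
    unfold HasFiniteIntegral
    rw [lintegral_prod _ hHm.enorm]
    exact hH1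
  have hψm : AEStronglyMeasurable (uncurry ψ) ((volume.restrict (Ioo 0 T)).prod (volume : Measure (UnitAddTorus (Fin 2)))) :=
    hψ.continuous_uncurry.aestronglyMeasurable
  have hbd : ∀ᵐ p ∂((volume.restrict (Ioo 0 T)).prod (volume : Measure (UnitAddTorus (Fin 2)))), ‖uncurry ψ p‖ ≤ M := by
    have hs : ∀ᵐ p ∂((volume.restrict (Ioo 0 T)).prod (volume : Measure (UnitAddTorus (Fin 2)))), p.1 ∈ Ioo 0 T :=
      (Measure.quasiMeasurePreserving_fst (μ := volume.restrict (Ioo 0 T)) (ν := (volume : Measure (UnitAddTorus (Fin 2))))).ae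
        (ae_restrict_mem measurableSet_Ioo)
    exact hs.mono fun p hp => hM p.1 (Ioo_subset_Icc_self hp) p.2
  have h := hHi.mul_bdd hψm hbd
  refine h.congr (ae_of_all _ fun p => ?_)
  rfl

/-- **The vertical section of a `2½`-dimensional forced weak Navier–Stokes solution is a weak
sourced passive scalar on `T²`.** If `u(t) = (v(t), θ(t)) ∘ π` is a forced weak solution on
`T³ × [0, T)` with force `(G(t), H(t)) ∘ π` and datum `(v₀, θ₀) ∘ π`, with `u(t) ∈ L²(T³)` of
uniformly bounded norm for `t ∈ (0, T)`, `θ₀ ∈ L²`, and a jointly measurable source `H` in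
`L¹((0,T) × T²)`, then `θ` is a weak solution of `∂ₜθ + v·∇θ = νΔθ + H` on `T² × [0, T)` with
datum `θ₀` in the accepted sense `Torus.IsWeakScalarTransportForcedOn` (test the three-dimensional
identity with the vertical lifts `(0, ψ(t)) ∘ π`; Majda–Bertozzi 2002, §2.3.1, Prop. 2.7;
DiPerna–Lions 1989, §II.1). [folklore] -/
theorem isWeakScalarTransportForcedOn_of_twoHalf
    (hu : IsWeakNSSolutionForcedOn T ν (fun t => twoHalf (G t) (H t)) (twoHalf v₀ θ₀) (fun t => twoHalf (v t) (θ t)))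
    (h2 : ∀ t ∈ Ioo 0 T, MemLp (twoHalf (v t) (θ t)) 2 (volume : Measure (UnitAddTorus (Fin 3))))
    {C : ℝ≥0} (hC : ∀ t ∈ Ioo 0 T, ∫⁻ x, ‖twoHalf (v t) (θ t) x‖ₑ ^ 2 ≤ C)
    (hθ₀ : MemLp θ₀ 2 volume)
    (hHm : AEStronglyMeasurable (uncurry H) ((volume.restrict (Ioo 0 T)).prod (volume : Measure (UnitAddTorus (Fin 2)))))
    (hH1 : ∫⁻ t in Ioo 0 T, ∫⁻ y, ‖H t y‖ₑ < ⊤) :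
    IsWeakScalarTransportForcedOn T ν v H θ₀ θ := by
  obtain ⟨hm, hL2, hdiv, hweak⟩ := hu
  have hm' := aestronglyMeasurable_uncurry_of_stLift_prod hm
  have hvm := aestronglyMeasurable_uncurry_of_twoHalf_left hm'
  have hθm := aestronglyMeasurable_uncurry_of_twoHalf_right hm'
  have hv : ∀ t ∈ Ioo 0 T, MemLp (v t) 2 volume := fun t ht => (memLp_of_twoHalf (h2 t ht)).1
  have hθ : ∀ t ∈ Ioo 0 T, MemLp (θ t) 2 volume := fun t ht => (memLp_of_twoHalf (h2 t ht)).2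
  -- real uniform bounds on the sections
  have hCv : ∀ t ∈ Ioo 0 T, ∫ y, ‖v t y‖ ^ 2 ≤ (C : ℝ) := fun t ht => by
    rw [integral_norm_sq_eq_toReal_lintegral (hv t ht)]
    have h := (lintegral_enorm_sq_left_le_twoHalf (v t) (θ t)).trans (hC t ht)
    have := ENNReal.toReal_mono ENNReal.coe_ne_top h
    rwa [ENNReal.coe_toReal] at this
  have hCθ : ∀ t ∈ Ioo 0 T, ∫ y, ‖θ t y‖ ^ 2 ≤ (C : ℝ) := fun t ht => by
    rw [integral_norm_sq_eq_toReal_lintegral (hθ t ht)]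
    have h := (lintegral_enorm_sq_right_le_twoHalf (v t) (θ t)).trans (hC t ht)
    have := ENNReal.toReal_mono ENNReal.coe_ne_top h
    rwa [ENNReal.coe_toReal] at this
  have hCae : ∀ᵐ t ∂(volume.restrict (Ioo 0 T)), ∫⁻ x, ‖twoHalf (v t) (θ t) x‖ₑ ^ 2 ≤ C := by
    filter_upwards [ae_restrict_mem measurableSet_Ioo] with t ht
    exact hC t ht
  refine ⟨(aestronglyMeasurable_stLift_of_twoHalf hm).2, (aestronglyMeasurable_stLift_of_twoHalf hm).1,
    aestronglyMeasurable_stLift_of_uncurry hHm, ?_, ?_, ?_, hH1, ?_, fun ψ hψ => ?_⟩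
  · -- `θ ∈ L^∞ L²`
    refine ⟨C, ?_⟩
    filter_upwards [hCae] with t ht
    exact (lintegral_enorm_sq_right_le_twoHalf (v t) (θ t)).trans ht
  · -- `v ∈ L¹ L²`
    have hb : ∀ᵐ t ∂(volume.restrict (Ioo 0 T)), (∫⁻ y, ‖v t y‖ₑ ^ 2) ^ (1 / 2 : ℝ) ≤ (C : ℝ≥0∞) ^ (1 / 2 : ℝ) := by
      filter_upwards [hCae] with t ht
      exact ENNReal.rpow_le_rpow ((lintegral_enorm_sq_left_le_twoHalf (v t) (θ t)).trans ht) (by norm_num)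
    calc ∫⁻ t in Ioo 0 T, (∫⁻ y, ‖v t y‖ₑ ^ 2) ^ (1 / 2 : ℝ)
        ≤ ∫⁻ _ in Ioo 0 T, (C : ℝ≥0∞) ^ (1 / 2 : ℝ) := lintegral_mono_ae hb
      _ = (C : ℝ≥0∞) ^ (1 / 2 : ℝ) * volume (Ioo (0 : ℝ) T) := setLIntegral_const _ _
      _ < ⊤ := ENNReal.mul_lt_top (ENNReal.rpow_lt_top_of_nonneg (by norm_num) ENNReal.coe_ne_top) measure_Ioo_lt_top
  · -- `v θ ∈ L¹`
    exact lt_of_le_of_lt (lintegral_mono fun t => lintegral_enorm_mul_le_twoHalf (v t) (θ t)) hL2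
  · -- weak incompressibility
    filter_upwards [hdiv, ae_restrict_mem measurableSet_Ioo] with t ht htI
    exact isWeaklyDivFree_of_twoHalf (hv t htI) ht
  · -- the weak identity, tested with the vertical lift `(0, ψ) ∘ π`
    have hid := hweak (fun t => twoHalf 0 (ψ t)) (isSpaceTimeTest_twoHalf_right hψ) (isDivFreeTest_twoHalf_right ψ)
    -- the source pairing on the product and its slices
    have hSrc := integrable_uncurry_source_mul hψ hHm hH1
    have hSrc_slice : ∀ᵐ t ∂(volume.restrict (Ioo 0 T)), Integrable (fun y => H t y * ψ t y) volume :=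
      hSrc.prod_right_ae
    have hSrc_time : IntegrableOn (fun t => ∫ y, H t y * ψ t y) (Ioo 0 T) volume := hSrc.integral_prod_left
    -- slice-wise descent of the three-dimensional integrand
    have hslice : ∀ᵐ t ∂(volume.restrict (Ioo 0 T)),
        (∫ x, (⟪twoHalf (v t) (θ t) x, FunctionSpaces.Torus.timeDeriv (fun s => twoHalf 0 (ψ s)) t x⟫_ℝ +
          ⟪twoHalf (v t) (θ t) x, FunctionSpaces.Torus.convect (twoHalf (v t) (θ t)) (twoHalf 0 (ψ t)) x⟫_ℝ +
          ν * ⟪twoHalf (v t) (θ t) x, FunctionSpaces.Torus.laplacian (twoHalf 0 (ψ t)) x⟫_ℝ +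
          ⟪twoHalf (G t) (H t) x, twoHalf 0 (ψ t) x⟫_ℝ)) =
        (∫ y, θ t y * (FunctionSpaces.Torus.timeDeriv ψ t y + ⟪v t y, FunctionSpaces.Torus.gradient (ψ t) y⟫_ℝ +
          ν * FunctionSpaces.Torus.laplacian (ψ t) y)) + ∫ y, H t y * ψ t y := by
      filter_upwards [hSrc_slice, ae_restrict_mem measurableSet_Ioo] with t hHt ht
      have hs : IsSmooth (ψ t) := hψ.isSmooth_slice t
      have hpt : ∀ x : (UnitAddTorus (Fin 3)),
          ⟪twoHalf (v t) (θ t) x, FunctionSpaces.Torus.timeDeriv (fun s => twoHalf 0 (ψ s)) t x⟫_ℝ +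
            ⟪twoHalf (v t) (θ t) x, FunctionSpaces.Torus.convect (twoHalf (v t) (θ t)) (twoHalf 0 (ψ t)) x⟫_ℝ +
            ν * ⟪twoHalf (v t) (θ t) x, FunctionSpaces.Torus.laplacian (twoHalf 0 (ψ t)) x⟫_ℝ +
            ⟪twoHalf (G t) (H t) x, twoHalf 0 (ψ t) x⟫_ℝ =
          (fun y => θ t y * (FunctionSpaces.Torus.timeDeriv ψ t y + ⟪v t y, FunctionSpaces.Torus.gradient (ψ t) y⟫_ℝ +
            ν * FunctionSpaces.Torus.laplacian (ψ t) y) + H t y * ψ t y) (planarProj x) := by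
        intro x
        rw [timeDeriv_twoHalf_right hψ, inner_twoHalf_vertical, inner_twoHalf_convect_vertical _ _ (hs.isContDiff (by simp)),
          inner_twoHalf_laplacian_vertical _ _ hs, inner_twoHalf_vertical]
        ring
      simp_rw [hpt]
      have hI := integrable_scalarIntegrand (ν := ν) hψ (hv t ht) (hθ t ht)
      refine Eq.trans (integral_comp_planarProj (b := fun y => θ t y * (FunctionSpaces.Torus.timeDeriv ψ t y +
        ⟪v t y, FunctionSpaces.Torus.gradient (ψ t) y⟫_ℝ + ν * FunctionSpaces.Torus.laplacian (ψ t) y) + H t y * ψ t y)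
        (hI.add hHt).aestronglyMeasurable) ?_
      exact integral_add hI hHt
    have hdatum : ∫ x, ⟪twoHalf v₀ θ₀ x, twoHalf 0 (ψ 0) x⟫_ℝ = ∫ y, θ₀ y * ψ 0 y := by
      simp_rw [inner_twoHalf_vertical]
      exact integral_comp_planarProj (hθ₀.integrable_mul ((hψ.isSmooth_slice 0).memLp 2)).aestronglyMeasurable
    have hA := integrableOn_integral_scalarIntegrand (ν := ν) hψ hvm hθm hv hθ hCv hCθ
    rw [integral_congr_ae hslice, integral_add hA hSrc_time, hdatum] at hid
    exact hid

end ScalarWeak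

end Torus

end Literature.Analysis.FluidPDE

end
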